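import Mathlib
import Summits.ValiantsHypothesis.ValiantsHypothesis.Theses.ProofCarryingSymmetry
import Summits.ValiantsHypothesis.ValiantsHypothesis.Theorems.ProofCarryingSymmetrySquareSymmetricPermLB
import Summits.ValiantsHypothesis.ValiantsHypothesis.Theorems.ProofCarryingSymmetryRestorationQPPolylogWidth
import Literature.Computability.AlgebraicComplexity.ValiantConjectureEquivProofs

/-!
# Crux `RestorationQP` (stmt-ValiantsHypothesis-10343) — strategy census s10, Lean companion

Strategist seat `cstrat-stmt-ValiantsHypothesis-10343-s10` (second independent census).  This file
types and PROVES the two facts on which the census verdict `no-strategy-short-of-summit` rests; it is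
pure composition of tree theorems (no `sorry`, no named facts, no new definitions of substance).

1. **The per-shadow of the crux is the summit, exactly.**  `PerRestorationQP` (the crux instantiated
   at the one family the route ever feeds it, `f = per`) is EQUIVALENT to `ValiantsHypothesis`
   (`perRestorationQP_iff_valiantsHypothesis`): `⇒` by Dawar–Wilsenach Thm 7.1 (tree:
   `squareSymmetricPermLB_proof`) and the hub lemma; `⇐` because `VP ≠ VNP` makes the premise
   `per ∈ VP` false (`perFamily_mem_VP_iff_VP_eq_VNP`, von zur Gathen 1987 Prop. 4.8 / Valiant 1979).
   So at `per` the language switch "symmetric circuits" has no teeth: the instance is `S` itself, and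
   the general crux is `S` plus a restoration claim about families other than `per`.

2. **Every factorisation of the crux through an intermediate property `Φ` has a summit-strength
   factor** (`pieces_dichotomy`): writing the crux as `NecessityPiece Φ ∧ SufficiencyPiece Φ → crux`
   ("every invariant VP family has `Φ`" and "invariant VP families with `Φ` have quasi-polynomial
   symmetric circuits"), the per-shadows of the two pieces are, provably,
   `S ∨ Φ(per)` (`necessityShadow_iff`) and `S ∨ ¬Φ(per)` (`sufficiencyShadow_iff`).  Hence whichever
   way `Φ(per)` is decided, one piece is summit-equivalent at `per` (and its general form is `≥ S`),
   and while `Φ(per)` is undecided the split merely hides `S` behind the open question `Φ(per)`.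
   Instances (census §Decomposition): `Φ` = polylog counting width (D1; `Φ(per)` false by DW Thm 7.2,
   so the necessity piece alone gives `S` — landed as `valiantsHypothesis_of_widthLawVP`, re-derived
   below), `Φ` = quasi-polynomial equivariant determinantal/ABP representation (D3; `Φ(per)` false by
   the same lower bound), `Φ` = quasi-polynomial proof-carrying circuits (the registered line T′ ∧ L;
   `Φ(per)` open, which is exactly why that line is conjecture-grade on both stubs).
-/

-- single-problem summit: `Summit.ValiantsHypothesis.ValiantsHypothesis.…` is the namespace by design (D-0017)
set_option linter.dupNamespace false

noncomputable section

open scoped Classical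

namespace Summit.ValiantsHypothesis.ValiantsHypothesis.Cruxes.RestorationQP.StrategyCensusS10

open Literature.Computability.AlgebraicComplexity
open Literature.ModelTheory.FiniteModelTheory
open Summit.ValiantsHypothesis.ValiantsHypothesis.Theses.ProofCarryingSymmetry (RestorationQP SquareSymmetricPermLB)

/-- An invariant family of polynomial matrices' worth of variables: `f_n ∈ ℂ[x_ij : i, j < n]`. -/
abbrev Family : Type := (n : ℕ) → MvPolynomial (Fin n × Fin n) ℂ

/-- Diagonal `S_n`-invariance of a family (the crux's first hypothesis). -/
def IsDiagInvariant (f : Family) : Prop :=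
  ∀ (n : ℕ) (σ : Equiv.Perm (Fin n)), MvPolynomial.rename (fun x : Fin n × Fin n => σ • x) (f n) = f n

/-- The crux's conclusion for one family: `S_n`-symmetric labelled circuits of size
`≤ 2^{(log₂ n + c)^c}` computing `f_n`, uniformly in `n`. -/
def HasSymQP (f : Family) : Prop :=
  ∃ c : ℕ, ∀ n : ℕ, ∃ (G : Type) (_ : Fintype G)
    (C : LabelledArithCircuit ℂ (Fin n × Fin n) Unit G),
    C.IsSymmetric (Equiv.Perm (Fin n)) ∧ C.eval (C.output ()) = f n ∧
      Fintype.card G ≤ 2 ^ ((Nat.log 2 n + c) ^ c)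

/-- The permanent family in the crux's variable convention. -/
def per : Family := fun n => perPoly (Fin n) ℂ

/-- The crux, re-read through the abbreviations (definitionally the route decl). -/
theorem restorationQP_iff :
    RestorationQP ↔ ∀ f : Family, IsDiagInvariant f → IsVPFamily f → HasSymQP f := Iff.rfl

/-! ### 1. The per-shadow of the crux is the summit -/

/-- **The per-restricted crux**: if the permanent is in VP then it has quasi-polynomial
`S_n`-symmetric circuits. -/
def PerRestorationQP : Prop := IsVPFamily per → HasSymQP per

/-- The crux gives its per-instance (`per` is diagonally invariant, `rename_smul_perPoly`). [folklore] -/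
theorem perRestorationQP_of_restorationQP (hR : RestorationQP) : PerRestorationQP :=
  fun hVP => hR per (fun n σ => Summit.ValiantsHypothesis.Theorems.ProofCarryingSymmetry.rename_smul_perPoly n σ) hVP

/-- `VP_ℂ ≠ VNP_ℂ` ⇒ the permanent is not a VP family (VNP-completeness of `per`,
`perFamily_mem_VP_iff_VP_eq_VNP`, and the renaming bridge `mem_VP_ofFintype_iff_holds`).
[cite: Vonzurgathen1987Feasible, Prop. 4.8] -/
theorem not_isVPFamily_per_of_valiantsHypothesis (h : _root_.ValiantsHypothesis) : ¬ IsVPFamily per := by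
  intro hVP
  have h' : VP ℂ ≠ VNP ℂ := h
  exact h' ((perFamily_mem_VP_iff_VP_eq_VNP ℂ ringChar_complex_ne_two).1
    ((mem_VP_ofFintype_iff_holds (fun n => perPoly (Fin n) ℂ)).2 hVP))

/-- `¬ (VP_ℂ ≠ VNP_ℂ)` ⇒ the permanent is a VP family (hub lemma, contraposed). [folklore] -/
theorem isVPFamily_per_of_not_valiantsHypothesis (h : ¬ _root_.ValiantsHypothesis) : IsVPFamily per := by
  by_contra hVP
  exact h (Summit.ValiantsHypothesis.Hub.valiantsHypothesis_of_not_isVPFamily_per hVP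
    (mem_VP_ofFintype_iff_holds _) (perFamily_mem_VNP_holds ℂ))

/-- `S ↔ per ∉ VP` in the crux's convention. [cite: Vonzurgathen1987Feasible, Prop. 4.8] -/
theorem valiantsHypothesis_iff_not_isVPFamily_per : _root_.ValiantsHypothesis ↔ ¬ IsVPFamily per :=
  ⟨not_isVPFamily_per_of_valiantsHypothesis, fun h => by
    by_contra hS
    exact h (isVPFamily_per_of_not_valiantsHypothesis hS)⟩

/-- **The permanent has no quasi-polynomial symmetric circuits** (Dawar–Wilsenach Thm 7.1 in size
form, tree `squareSymmetricPermLB_proof`, against `2^{(log₂ n + c)^c} = 2^{o(n)}`,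
`natLog_add_pow_lt_mul_eventually`). [cite: DawarWilsenach2025, Thm. 7.1] -/
theorem not_hasSymQP_per : ¬ HasSymQP per := by
  rintro ⟨c, hc⟩
  choose G hG C hsym heval hcard using hc
  have hLB : SquareSymmetricPermLB := Theorems.squareSymmetricPermLB_proof
  obtain ⟨ε, hε, hio⟩ := @hLB G hG C hsym heval
  obtain ⟨n₀, hn₀⟩ :=
    Summit.ValiantsHypothesis.Theorems.ProofCarryingSymmetry.natLog_add_pow_lt_mul_eventually c hε
  obtain ⟨n, hn, hle⟩ := hio n₀
  have h1 : (Fintype.card (G n) : ℝ) ≤ (2 : ℝ) ^ (((Nat.log 2 n + c) ^ c : ℕ) : ℝ) := by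
    rw [Real.rpow_natCast]
    exact_mod_cast hcard n
  have h2 : ε * n ≤ (((Nat.log 2 n + c) ^ c : ℕ) : ℝ) :=
    (Real.rpow_le_rpow_left_iff one_lt_two).1 (hle.trans h1)
  exact absurd (hn₀ n hn) (not_lt.2 h2)

/-- **Per-shadow ⇒ summit.** [folklore] -/
theorem valiantsHypothesis_of_perRestorationQP (hP : PerRestorationQP) : _root_.ValiantsHypothesis := by
  by_contra hS
  exact not_hasSymQP_per (hP (isVPFamily_per_of_not_valiantsHypothesis hS))

/-- **Summit ⇒ per-shadow** (vacuously: the premise `per ∈ VP` fails). [folklore] -/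
theorem perRestorationQP_of_valiantsHypothesis (h : _root_.ValiantsHypothesis) : PerRestorationQP :=
  fun hVP => absurd hVP (not_isVPFamily_per_of_valiantsHypothesis h)

/-- **THE PER-SHADOW OF THE CRUX IS THE SUMMIT**: `PerRestorationQP ↔ ValiantsHypothesis`.  The one
instance of `RestorationQP` the route's `closes` consumes is literally equivalent to `S`; the crux is
`S` conjoined with restoration for the invariant VP families other than `per`. [folklore] -/
theorem perRestorationQP_iff_valiantsHypothesis : PerRestorationQP ↔ _root_.ValiantsHypothesis :=
  ⟨valiantsHypothesis_of_perRestorationQP, perRestorationQP_of_valiantsHypothesis⟩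

/-- (Recorded: the crux is at least the summit — tree `valiantsHypothesis_of_restorationQP'`, here
through the per-shadow.) [folklore] -/
theorem valiantsHypothesis_of_restorationQP (hR : RestorationQP) : _root_.ValiantsHypothesis :=
  valiantsHypothesis_of_perRestorationQP (perRestorationQP_of_restorationQP hR)

/-! ### 2. Every factorisation through an intermediate property has a summit-strength factor -/

/-- Necessity piece of a `Φ`-factorisation: every diagonally invariant VP family has `Φ`. -/
def NecessityPiece (Φ : Family → Prop) : Prop :=
  ∀ f : Family, IsDiagInvariant f → IsVPFamily f → Φ f

/-- Sufficiency piece of a `Φ`-factorisation: invariant VP families with `Φ` restore at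
quasi-polynomial cost. -/
def SufficiencyPiece (Φ : Family → Prop) : Prop :=
  ∀ f : Family, IsDiagInvariant f → IsVPFamily f → Φ f → HasSymQP f

/-- The factorisation is a factorisation (one line). [folklore] -/
theorem restorationQP_of_pieces (Φ : Family → Prop) (h₁ : NecessityPiece Φ) (h₂ : SufficiencyPiece Φ) :
    RestorationQP :=
  fun f hinv hVP => h₂ f hinv hVP (h₁ f hinv hVP)

/-- Conversely every proof of the crux is such a factorisation (take `Φ = HasSymQP`), so the scheme
is fully general among "property of the family" splits. [folklore] -/
theorem pieces_of_restorationQP (hR : RestorationQP) :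
    NecessityPiece HasSymQP ∧ SufficiencyPiece HasSymQP :=
  ⟨fun f hinv hVP => hR f hinv hVP, fun _ _ _ h => h⟩

theorem isDiagInvariant_per : IsDiagInvariant per :=
  fun n σ => Summit.ValiantsHypothesis.Theorems.ProofCarryingSymmetry.rename_smul_perPoly n σ

/-- **Per-shadow of the necessity piece is `S ∨ Φ(per)`.** [folklore] -/
theorem necessityShadow_iff (Φ : Family → Prop) :
    (IsVPFamily per → Φ per) ↔ (_root_.ValiantsHypothesis ∨ Φ per) := by
  constructor
  · intro h
    by_cases hS : _root_.ValiantsHypothesis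
    · exact Or.inl hS
    · exact Or.inr (h (isVPFamily_per_of_not_valiantsHypothesis hS))
  · rintro (hS | hΦ) hVP
    · exact absurd hVP (not_isVPFamily_per_of_valiantsHypothesis hS)
    · exact hΦ

/-- **Per-shadow of the sufficiency piece is `S ∨ ¬Φ(per)`** (because `HasSymQP per` is false,
Dawar–Wilsenach). [cite: DawarWilsenach2025, Thm. 7.1] -/
theorem sufficiencyShadow_iff (Φ : Family → Prop) :
    (IsVPFamily per → Φ per → HasSymQP per) ↔ (_root_.ValiantsHypothesis ∨ ¬ Φ per) := by
  constructor
  · intro h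
    by_cases hS : _root_.ValiantsHypothesis
    · exact Or.inl hS
    · exact Or.inr fun hΦ => not_hasSymQP_per (h (isVPFamily_per_of_not_valiantsHypothesis hS) hΦ)
  · rintro (hS | hΦ) hVP hΦper
    · exact absurd hVP (not_isVPFamily_per_of_valiantsHypothesis hS)
    · exact absurd hΦper hΦ

/-- **DICHOTOMY: one factor of every `Φ`-factorisation proves the summit on its own.**  If `Φ(per)`
holds, the sufficiency piece (at `per`) gives `S`; if not, the necessity piece (at `per`) gives `S`.
So no `Φ`-split of the crux passes the "no piece gives `S` alone" test (BC2(c)) once `Φ(per)` is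
decided, and an undecided `Φ(per)` is where such a split hides the summit. [folklore] -/
theorem pieces_dichotomy (Φ : Family → Prop) :
    (NecessityPiece Φ → _root_.ValiantsHypothesis) ∨ (SufficiencyPiece Φ → _root_.ValiantsHypothesis) := by
  by_cases hΦ : Φ per
  · refine Or.inr fun h₂ => ?_
    have h := (sufficiencyShadow_iff Φ).1 (h₂ per isDiagInvariant_per)
    exact h.resolve_right (not_not.2 hΦ)
  · refine Or.inl fun h₁ => ?_
    have h := (necessityShadow_iff Φ).1 (h₁ per isDiagInvariant_per)
    exact h.resolve_right hΦ

/-- The decided cases, pointwise. [folklore] -/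
theorem valiantsHypothesis_of_sufficiencyPiece (Φ : Family → Prop) (hΦ : Φ per)
    (h₂ : SufficiencyPiece Φ) : _root_.ValiantsHypothesis :=
  ((sufficiencyShadow_iff Φ).1 (h₂ per isDiagInvariant_per)).resolve_right (not_not.2 hΦ)

theorem valiantsHypothesis_of_necessityPiece (Φ : Family → Prop) (hΦ : ¬ Φ per)
    (h₁ : NecessityPiece Φ) : _root_.ValiantsHypothesis :=
  ((necessityShadow_iff Φ).1 (h₁ per isDiagInvariant_per)).resolve_right hΦ

/-! ### Instance D1: `Φ` = polylogarithmic counting width of the Boolean shadow -/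

/-- D1's intermediate property: uniformly polylog counting width on `0/1` adjacency matrices (the
hypothesis of tree `valiantsHypothesis_of_widthLawVP`, per family). -/
def PolylogWidth (f : Family) : Prop :=
  ∃ c' : ℕ, ∀ (n : ℕ) (X Y : SimpleGraph (Fin n)),
    CkEquiv ((Nat.log 2 n + c') ^ c') X Y →
      MvPolynomial.eval (Set.indicator {ij : Fin n × Fin n | X.Adj ij.1 ij.2} 1) (f n) =
        MvPolynomial.eval (Set.indicator {ij : Fin n × Fin n | Y.Adj ij.1 ij.2} 1) (f n)

/-- D1's necessity piece is the tree's width law, which ALONE decides the summit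
(`valiantsHypothesis_of_widthLawVP`; `Φ(per)` is false by Dawar–Wilsenach Thm 7.2). So the split
`WidthLawVP ∧ RestorationFromWidthQP → RestorationQP` fails BC2(c). [folklore] -/
theorem d1_necessityPiece_gives_summit (h₁ : NecessityPiece PolylogWidth) : _root_.ValiantsHypothesis :=
  Theorems.valiantsHypothesis_of_widthLawVP fun f hinv hVP => h₁ f hinv hVP

/-- And the crux gives D1's necessity piece (tree `widthLawVP_of_restorationQP`), so D1's first
factor is sandwiched `crux ⇒ WidthLaw ⇒ S`. [folklore] -/
theorem d1_necessityPiece_of_restorationQP (hR : RestorationQP) : NecessityPiece PolylogWidth :=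
  fun f hinv hVP => Theorems.widthLawVP_of_restorationQP hR f hinv hVP

end Summit.ValiantsHypothesis.ValiantsHypothesis.Cruxes.RestorationQP.StrategyCensusS10

end
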